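import Mathlib

/-!
# Helper for stubs 3/4 of line `conformal-kernel-domination` (crux stmt-SmoothPoincare4-7632):
# the conformal map `Φ(x,s) = eˢ x` is `e^{t₀+η}`-Lipschitz on the slab `S⁴ × [t₀-η, t₀+η]` of `N`.

refuter-drefute-stmt-SmoothPoincare4-7632-0 (evidence for the provers of `stub_groundStateContinuity` /
`stub_smallScaleDomination`; positive helper, not landed by the refuter).

The one-line identity behind it: for `z, z' ∈ N` (i.e. `∑_{i<5} zᵢ² = ∑_{i<5} z'ᵢ² = 1`), writing
`a = z₅`, `b = z'₅`,
  `‖Φ z - Φ z'‖² = (eᵃ - eᵇ)² + e^{a+b} · ∑_{i<5} (zᵢ - z'ᵢ)²`,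
and `|eᵃ - eᵇ| ≤ e^{max a b} |a - b|`, `e^{a+b} ≤ e^{2 max a b}`; hence on the slab `|z₅ - t₀| ≤ η` the map
`Φ` is `e^{t₀+η}`-Lipschitz for the ambient `ℝ⁶`-metric (GLOBAL constant, no localisation needed), so
`μH[d] (Φ '' S) ≤ e^{d(t₀+η)} μH[d] S` for every `S` in the slab (`LipschitzOnWith.hausdorffMeasure_image_le`).
-/

noncomputable section

open Real

namespace DrefuteCKD

local notation "E5" => EuclideanSpace ℝ (Fin 5)
local notation "E6" => EuclideanSpace ℝ (Fin 6)

/-- Copy of the skeleton's `conformalMap` (Lines/conformal-kernel-domination.lean). -/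
def conformalMap (z : E6) : E5 :=
  WithLp.toLp 2 (fun i : Fin 5 => Real.exp (z 5) * z (Fin.castSucc i))

@[simp] theorem conformalMap_apply (z : E6) (i : Fin 5) :
    conformalMap z i = Real.exp (z 5) * z (Fin.castSucc i) := rfl

/-- The squared norm on `EuclideanSpace ℝ (Fin n)` as a plain sum of squares. -/
theorem norm_sq_eq_sum {n : ℕ} (x : EuclideanSpace ℝ (Fin n)) : ‖x‖ ^ 2 = ∑ i, x i ^ 2 := by
  rw [EuclideanSpace.norm_eq, Real.sq_sqrt (Finset.sum_nonneg fun i _ => by positivity)]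
  exact Finset.sum_congr rfl fun i _ => by rw [Real.norm_eq_abs, sq_abs]

/-- **The key identity.** For `z, z'` on the cylinder `N`,
`‖Φ z - Φ z'‖² = (e^{z₅} - e^{z'₅})² + e^{z₅} e^{z'₅} ∑_{i<5} (zᵢ - z'ᵢ)²`. -/
theorem norm_conformalMap_sub_sq (z z' : E6) (hz : ∑ i : Fin 5, z (Fin.castSucc i) ^ 2 = 1)
    (hz' : ∑ i : Fin 5, z' (Fin.castSucc i) ^ 2 = 1) :
    ‖conformalMap z - conformalMap z'‖ ^ 2 =
      (Real.exp (z 5) - Real.exp (z' 5)) ^ 2 +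
        Real.exp (z 5) * Real.exp (z' 5) * ∑ i : Fin 5, (z (Fin.castSucc i) - z' (Fin.castSucc i)) ^ 2 := by
  rw [norm_sq_eq_sum]
  simp only [PiLp.sub_apply, conformalMap_apply]
  set a := Real.exp (z 5)
  set b := Real.exp (z' 5)
  have h1 : ∑ i : Fin 5, (a * z (Fin.castSucc i) - b * z' (Fin.castSucc i)) ^ 2 =
      a ^ 2 * ∑ i : Fin 5, z (Fin.castSucc i) ^ 2 + b ^ 2 * ∑ i : Fin 5, z' (Fin.castSucc i) ^ 2 -
        2 * a * b * ∑ i : Fin 5, z (Fin.castSucc i) * z' (Fin.castSucc i) := by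
    rw [Finset.mul_sum, Finset.mul_sum, Finset.mul_sum, ← Finset.sum_add_distrib, ← Finset.sum_sub_distrib]
    exact Finset.sum_congr rfl fun i _ => by ring
  have h2 : ∑ i : Fin 5, (z (Fin.castSucc i) - z' (Fin.castSucc i)) ^ 2 =
      ∑ i : Fin 5, z (Fin.castSucc i) ^ 2 + ∑ i : Fin 5, z' (Fin.castSucc i) ^ 2 -
        2 * ∑ i : Fin 5, z (Fin.castSucc i) * z' (Fin.castSucc i) := by
    rw [Finset.mul_sum, ← Finset.sum_add_distrib, ← Finset.sum_sub_distrib]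
    exact Finset.sum_congr rfl fun i _ => by ring
  rw [h1, h2, hz, hz']
  ring

/-- The squared ambient distance on `ℝ⁶` splits as base part plus height part. -/
theorem norm_sub_sq_eq (z z' : E6) :
    ‖z - z'‖ ^ 2 = ∑ i : Fin 5, (z (Fin.castSucc i) - z' (Fin.castSucc i)) ^ 2 + (z 5 - z' 5) ^ 2 := by
  rw [norm_sq_eq_sum, Fin.sum_univ_castSucc]
  simp only [PiLp.sub_apply]
  rfl

/-- Mean-value bound for `exp`: `|eᵃ - eᵇ| ≤ e^{c} |a - b|` whenever `a, b ≤ c`. -/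
theorem abs_exp_sub_exp_le {a b c : ℝ} (ha : a ≤ c) (hb : b ≤ c) :
    |Real.exp a - Real.exp b| ≤ Real.exp c * |a - b| := by
  -- WLOG via the one-sided bound `eˣ - eʸ ≤ eˣ (x - y)` for `y ≤ x` (from `1 - t ≤ e^{-t}`)
  have key : ∀ x y : ℝ, y ≤ x → x ≤ c → Real.exp x - Real.exp y ≤ Real.exp c * (x - y) := by
    intro x y hyx hxc
    have h1 : 1 - (x - y) ≤ Real.exp (-(x - y)) := by
      have := Real.add_one_le_exp (-(x - y))
      linarith
    have h2 : Real.exp y = Real.exp x * Real.exp (-(x - y)) := by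
      rw [← Real.exp_add]; congr 1; ring
    have hx0 : 0 < Real.exp x := Real.exp_pos x
    have h3 : Real.exp x - Real.exp y ≤ Real.exp x * (x - y) := by
      rw [h2]; nlinarith
    have h4 : Real.exp x ≤ Real.exp c := Real.exp_le_exp.2 hxc
    nlinarith
  rcases le_total b a with hba | hab
  · rw [abs_of_nonneg (sub_nonneg.2 (Real.exp_le_exp.2 hba)), abs_of_nonneg (sub_nonneg.2 hba)]
    exact key a b hba ha
  · rw [abs_sub_comm, abs_of_nonneg (sub_nonneg.2 (Real.exp_le_exp.2 hab)), abs_sub_comm,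
      abs_of_nonneg (sub_nonneg.2 hab)]
    exact key b a hab hb

/-- **Squared Lipschitz bound on the slab**: for `z, z' ∈ N` with `z₅, z'₅ ≤ c`,
`‖Φ z - Φ z'‖² ≤ e^{2c} ‖z - z'‖²`. -/
theorem norm_conformalMap_sub_sq_le (z z' : E6) (hz : ∑ i : Fin 5, z (Fin.castSucc i) ^ 2 = 1)
    (hz' : ∑ i : Fin 5, z' (Fin.castSucc i) ^ 2 = 1) {c : ℝ} (h5 : z 5 ≤ c) (h5' : z' 5 ≤ c) :
    ‖conformalMap z - conformalMap z'‖ ^ 2 ≤ Real.exp c ^ 2 * ‖z - z'‖ ^ 2 := by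
  rw [norm_conformalMap_sub_sq z z' hz hz', norm_sub_sq_eq, mul_add]
  have hS : 0 ≤ ∑ i : Fin 5, (z (Fin.castSucc i) - z' (Fin.castSucc i)) ^ 2 :=
    Finset.sum_nonneg fun i _ => by positivity
  have hA : (Real.exp (z 5) - Real.exp (z' 5)) ^ 2 ≤ Real.exp c ^ 2 * (z 5 - z' 5) ^ 2 := by
    have h := abs_exp_sub_exp_le h5 h5'
    have h0 : 0 ≤ Real.exp c * |z 5 - z' 5| := by positivity
    calc (Real.exp (z 5) - Real.exp (z' 5)) ^ 2 = |Real.exp (z 5) - Real.exp (z' 5)| ^ 2 := by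
          rw [sq_abs]
      _ ≤ (Real.exp c * |z 5 - z' 5|) ^ 2 := pow_le_pow_left₀ (abs_nonneg _) h 2
      _ = Real.exp c ^ 2 * (z 5 - z' 5) ^ 2 := by rw [mul_pow, sq_abs]
  have hB : Real.exp (z 5) * Real.exp (z' 5) ≤ Real.exp c ^ 2 := by
    rw [sq]
    exact mul_le_mul (Real.exp_le_exp.2 h5) (Real.exp_le_exp.2 h5') (Real.exp_pos _).le
      (Real.exp_pos _).le
  have hB' : Real.exp (z 5) * Real.exp (z' 5) * ∑ i : Fin 5, (z (Fin.castSucc i) - z' (Fin.castSucc i)) ^ 2 ≤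
      Real.exp c ^ 2 * ∑ i : Fin 5, (z (Fin.castSucc i) - z' (Fin.castSucc i)) ^ 2 :=
    mul_le_mul_of_nonneg_right hB hS
  linarith

/-- The slab of the cylinder `N = {∑_{i<5} zᵢ² = 1}` below height `c`. -/
def cylBelow (c : ℝ) : Set E6 :=
  {z | ∑ i : Fin 5, z (Fin.castSucc i) ^ 2 = 1 ∧ z 5 ≤ c}

/-- **`Φ` is `e^{c}`-Lipschitz on `N ∩ {z₅ ≤ c}`** (in particular `e^{t₀+η}`-Lipschitz on the slab
`S⁴ × [t₀-η, t₀+η]`), for the ambient Euclidean metrics of `ℝ⁶` and `ℝ⁵`. -/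
theorem lipschitzOnWith_conformalMap (c : ℝ) :
    LipschitzOnWith (Real.toNNReal (Real.exp c)) conformalMap (cylBelow c) := by
  refine LipschitzOnWith.of_dist_le_mul fun z hz z' hz' => ?_
  rw [dist_eq_norm, dist_eq_norm, Real.coe_toNNReal _ (Real.exp_pos c).le]
  have h := norm_conformalMap_sub_sq_le z z' hz.1 hz'.1 hz.2 hz'.2
  have h0 : 0 ≤ Real.exp c * ‖z - z'‖ := by positivity
  rw [← mul_pow] at h
  exact (pow_le_pow_iff_left₀ (norm_nonneg _) h0 two_ne_zero).1 h

/-- Consequence used by stubs 3/4: **Hausdorff measure of conformal images on the slab**,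
`μH[d] (Φ '' S) ≤ e^{d c} · μH[d] S` for `S ⊆ N ∩ {z₅ ≤ c}` and `d ≥ 0`. -/
theorem hausdorffMeasure_image_conformalMap_le {S : Set E6} {c : ℝ} (hS : S ⊆ cylBelow c) {d : ℝ}
    (hd : 0 ≤ d) :
    MeasureTheory.Measure.hausdorffMeasure d (conformalMap '' S) ≤
      (Real.toNNReal (Real.exp c) : ENNReal) ^ d * MeasureTheory.Measure.hausdorffMeasure d S :=
  ((lipschitzOnWith_conformalMap c).mono hS).hausdorffMeasure_image_le hd

end DrefuteCKD

end
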